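import Summits.CriticalPhenomena.Ising3DConformalLimit.Theorems.EnergyNotSigmaSquaredGapForcesFarMergingRootOpacity
import Summits.CriticalPhenomena.Ising3DConformalLimit.Theses.MirrorHoelderCompactness
import HarnessLib

/-! # Root opacity from the bulk floor under two-point doubling — the one-drop counting
(line `screening-form-lemma-a1` of crux `GapForcesFarMerging`, item stmt-CriticalPhenomena-4468;
registered helper `rootOpacity_of_doubling_bulkFloor`)

Write `A(r;m) = pinchScreen n r m` (box size `n` large). The landed counting
`rootOpacity_of_floors_rootFloor` (file `…RootOpacityCounting`) uses the OCTAVE floors of `Floors` only to spread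
the total drop of the ladder over a positive density of octaves, so that one of them meets a `θ`-doubling window
of the critical two-point function. Under ALL-SCALE TWO-POINT DOUBLING (`TwoPointDoubling`, the open item
stmt-CriticalPhenomena-6150 of route `MirrorHoelderCompactness`, taken here as a HYPOTHESIS, never asserted)
every octave is windowed (`doublingWindow_of_twoPointDoubling`: with `n = 2^j`, `κ G(2^j e₁) ≤ G(2^{j+1} e₁)`),
so ONE drop octave per decay scale suffices and only the BULK floor `δ A(2^K;m) ≤ A(n;m)`
(`2^{K+3} ≤ m < 2^{K+4}`) is needed:
along a decay scale `m` the root floor `A(2^{k₀};m) ≥ η` (`rootFloor`, landed), the bulk floor and the decay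
`A(n;m) ≤ C m^{-κ} ≤ C' λ^{2K}` (`λ = 2^{-κ/2}`) are incompatible with `λ`-geometric growth
`A(2^{j+1};m) > λ A(2^j;m)` on all of `[k₀, K)` once `K - k₀ > q` (`C λ^q ≤ C'`; `drops_count` with no drop),
so there is a FIRST drop octave `k ∈ [k₀, K)`, at which `A(2^k;m) ≥ λ^{k-k₀} η > 0` (`exists_drop_of_lt`);
a pigeonhole over the finite range of `k` (`exists_frequently_of_eventually_exists`) makes one `k` serve
infinitely many box sizes, and `k₀ → ∞` gives `∃ᶠ k`. This makes the dependence
`crux ⇐ TwoPointDoubling ∧ BulkFloor ∧ HazardRelocation ∧ Unpin` of the line explicit.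
References: Aizenman–Duminil-Copin 2021 (arXiv:1912.07973), Def. 5.11 and Rem. 5.10 (regular scales);
the counting is elementary. -/

noncomputable section

namespace Summit.CriticalPhenomena.Ising3DConformalLimit.EnergyNotSigmaSquaredGapForcesFarMerging

open scoped symmDiff ENNReal
open MeasureTheory Filter Finset
open Literature.Probability.LatticeModels Literature.Probability.Percolation
open Summit.CriticalPhenomena.Ising3DConformalLimit.Theorems.GapForcesFarMerging.Negative (e₁ e₂ cc2 xR up dn)
open Summit.CriticalPhenomena.Ising3DConformalLimit.GapForcesFarMergingScreening

/-! ### One-rate ladders: the first drop -/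

/-- The first drop of a ladder below a geometric rate: if `0 < λ`, `0 < a(0)` and `a(t) < λ^t a(0)`, then some
step `i < t` drops, `a(i+1) ≤ λ a(i)`, from a positive value `0 < a(i)` (take the first drop: before it the
ladder grows at least geometrically, `a(i) ≥ λ^i a(0) > 0`). [folklore] -/
theorem exists_drop_of_lt (a : ℕ → ℝ) {lam : ℝ} (hlam : 0 < lam) (h0 : 0 < a 0) (t : ℕ)
    (h : a t < lam ^ t * a 0) : ∃ i < t, 0 < a i ∧ a (i + 1) ≤ lam * a i := by
  by_contra hne
  push Not at hne
  have key : ∀ i ≤ t, lam ^ i * a 0 ≤ a i := by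
    intro i
    induction i with
    | zero => intro; simp
    | succ i ih =>
      intro hi
      have h1 := ih (Nat.le_of_succ_le hi)
      have h2 : 0 < a i := lt_of_lt_of_le (by positivity) h1
      calc lam ^ (i + 1) * a 0 = lam * (lam ^ i * a 0) := by ring
        _ ≤ lam * a i := mul_le_mul_of_nonneg_left h1 hlam.le
        _ ≤ a (i + 1) := (hne i hi h2).le
  exact (not_le.2 h) (key t le_rfl)

/-! ### Every octave is windowed under two-point doubling -/

/-- Under all-scale two-point doubling `κ G(n e₁) ≤ G(2n e₁)` (`n ≥ 1`), every octave `k` carries a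
`κ`-doubling window (`n = 2^j`: `2^j • e₁ = (2^j) e₁`, `2^{j+1} = 2·2^j`).
[cite: AizenmanDuminilCopinAnnals2021, Def. 5.11 (P1) and Rem. 5.10] -/
theorem doublingWindow_of_twoPointDoubling
    (hTD : Summit.CriticalPhenomena.Ising3DConformalLimit.Theses.MirrorHoelderCompactness.TwoPointDoubling) :
    ∃ θ : ℝ, 0 < θ ∧ ∀ k : ℕ, DoublingWindow θ k := by
  obtain ⟨κ, hκ, hdoub⟩ := hTD
  refine ⟨κ, hκ, fun k j _ _ => ?_⟩
  rw [two_pow_smul_e₁, two_pow_smul_e₁]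
  have h := hdoub (2 ^ j) Nat.one_le_two_pow
  have h2 : ((2 ^ (j + 1) : ℕ) : ℤ) = 2 * ((2 ^ j : ℕ) : ℤ) := by push_cast; ring
  rwa [h2]

/-! ### The counting theorem -/

/-- **Root opacity from two-point doubling, decay and the bulk floor (registered helper).** Under all-scale
two-point doubling (item stmt-CriticalPhenomena-6150, a hypothesis), one-pinch screening decay
`A(n;m) ≤ C m^{-κ}` along infinitely many far scales `m` and the BULK floor `δ A(2^K;m) ≤ A(n;m)`
(`2^{K+3} ≤ m < 2^{K+4}`, `K` large) alone force `RootOpacityIO`: for infinitely many octaves `k` (all of them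
windowed) some far scale `m ≥ 2^{k+3}` carries a relative drop `A(2^{k+1};m) ≤ (1-c)A(2^k;m)` from a positive
value, for infinitely many box sizes, with `1 - c = 2^{-κ/2}` — the root floor `rootFloor` at the octave `k₀`,
geometric growth without drops and the squeeze `δ λ^{K-k₀} η ≤ C' λ^{2K}` give a first drop octave in `[k₀,K)`.
[cite: AizenmanDuminilCopinAnnals2021, Def. 5.11 and Rem. 5.10] -/
theorem rootOpacity_of_doubling_bulkFloor : Summit.CriticalPhenomena.Ising3DConformalLimit.Theses.MirrorHoelderCompactness.TwoPointDoubling → OnePinchScreeningDecay → (∃ δ : ℝ, 0 < δ ∧ ∀ᶠ k : ℕ in atTop, ∀ m : ℕ, 2 ^ (k + 3) ≤ m → m < 2 ^ (k + 4) → ∀ᶠ n : ℕ in atTop, δ * pinchScreen n (2 ^ k) m ≤ pinchScreen n n m) → RootOpacityIO := by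
  intro hTD hDecay hBulk
  classical
  obtain ⟨θ, hθ, hwin⟩ := doublingWindow_of_twoPointDoubling hTD
  obtain ⟨κ, C, hκ, hfreq⟩ := hDecay
  obtain ⟨δ, hδ, hbulk⟩ := hBulk
  -- the drop rate `λ = 2^{-κ/2}` (`c = 1 - λ`)
  set lam : ℝ := (2 : ℝ) ^ (-(κ / 2)) with hlam
  have hlam0 : 0 < lam := Real.rpow_pos_of_pos two_pos _
  have hlam1 : lam < 1 := Real.rpow_lt_one_of_one_lt_of_neg one_lt_two (by linarith)
  refine ⟨1 - lam, θ, by linarith, hθ, ?_⟩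
  -- threshold of the bulk floor
  obtain ⟨k₁, hk₁⟩ := Filter.eventually_atTop.1 hbulk
  refine Filter.frequently_atTop.2 fun k₀ => ?_
  -- the root floor at the root octave `k₀`, for `m ≥ m₁`
  obtain ⟨η, hη, hroot⟩ := rootFloor k₀
  obtain ⟨m₁, hm₁⟩ := Filter.eventually_atTop.1 hroot
  -- `C₂ λ^q ≤ 1`, `C₂ = max C 1 / (δ η)`
  set C₂ : ℝ := max C 1 / (δ * η) with hC₂
  have hC₂pos : 0 < C₂ := by positivity
  obtain ⟨q, hq⟩ : ∃ q : ℕ, C₂ * lam ^ q ≤ 1 := by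
    obtain ⟨q, hq⟩ := exists_pow_lt_of_lt_one (inv_pos.2 hC₂pos) hlam1
    exact ⟨q, (mul_le_mul_of_nonneg_left hq.le hC₂pos.le).trans_eq (mul_inv_cancel₀ hC₂pos.ne')⟩
  -- a decay scale `m ∈ [2^{K+3}, 2^{K+4})` with `K ≥ K₀`
  set K₀ : ℕ := k₀ + q + k₁ + 1 with hK₀
  obtain ⟨m, hmge, hm⟩ := hfreq.forall_exists_of_atTop (max (2 ^ (K₀ + 3)) m₁)
  have hm2 : 2 ^ (K₀ + 3) ≤ m := le_of_max_le_left hmge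
  have hmm₁ : m₁ ≤ m := le_of_max_le_right hmge
  have hm0 : m ≠ 0 := by have := Nat.one_le_two_pow (n := K₀ + 3); omega
  obtain ⟨K, hK⟩ : ∃ K : ℕ, K = Nat.log 2 m - 3 := ⟨_, rfl⟩
  have hlogK₀ : K₀ + 3 ≤ Nat.log 2 m := Nat.le_log_of_pow_le one_lt_two hm2
  have hmK : 2 ^ (K + 3) ≤ m := (show K + 3 = Nat.log 2 m by omega) ▸ Nat.pow_log_le_self 2 hm0
  have hmK' : m < 2 ^ (K + 4) :=
    (show Nat.log 2 m + 1 = K + 4 by omega) ▸ Nat.lt_pow_succ_log_self one_lt_two m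
  have hK₀K : K₀ ≤ K := by omega
  -- the large box sizes: decay at `m`, bulk floor at `(K,m)`, root floor at `k₀`
  have hE : ∀ᶠ n : ℕ in atTop, pinchScreen n n m ≤ C * (m : ℝ) ^ (-κ) ∧
      δ * pinchScreen n (2 ^ K) m ≤ pinchScreen n n m ∧ η ≤ pinchScreen n (2 ^ k₀) m :=
    hm.and ((hk₁ K (by omega) m hmK hmK').and (hm₁ m hmm₁))
  -- for each such `n`: a drop octave `k ∈ [k₀, K)` from a positive value
  have hstep : ∀ᶠ n : ℕ in atTop, ∃ k ∈ Ico k₀ K, 0 < pinchScreen n (2 ^ k) m ∧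
      pinchScreen n (2 ^ (k + 1)) m ≤ lam * pinchScreen n (2 ^ k) m := by
    filter_upwards [hE] with n hn
    obtain ⟨hdec, hblk, hrt⟩ := hn
    -- the ladder `a i = A(2^{k₀+i}; m)`, `i ≤ t = K - k₀`
    obtain ⟨a, ha⟩ : ∃ a : ℕ → ℝ, ∀ i, a i = pinchScreen n (2 ^ (k₀ + i)) m := ⟨_, fun _ => rfl⟩
    obtain ⟨t, ht⟩ : ∃ t : ℕ, t = K - k₀ := ⟨_, rfl⟩
    have ha0 : 0 < a 0 := by rw [ha]; exact lt_of_lt_of_le hη hrt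
    have hat : a t = pinchScreen n (2 ^ K) m := by rw [ha, show k₀ + t = K by omega]
    -- the decay in powers of `λ`: `m^{-κ} ≤ (2^{K+3})^{-κ} = λ^{2(K+3)}`
    have hdecay' : pinchScreen n n m ≤ max C 1 * lam ^ (2 * (K + 3)) := by
      have h1 : (m : ℝ) ^ (-κ) ≤ ((2 : ℝ) ^ (K + 3)) ^ (-κ) :=
        Real.rpow_le_rpow_of_nonpos (by positivity) (by exact_mod_cast hmK) (by linarith)
      have h2 : ((2 : ℝ) ^ (K + 3)) ^ (-κ) = lam ^ (2 * (K + 3)) := by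
        rw [hlam, ← Real.rpow_natCast (2 : ℝ) (K + 3), ← Real.rpow_mul (by norm_num : (0 : ℝ) ≤ 2),
          ← Real.rpow_natCast ((2 : ℝ) ^ (-(κ / 2))) (2 * (K + 3)),
          ← Real.rpow_mul (by norm_num : (0 : ℝ) ≤ 2)]
        congr 1; push_cast; ring
      calc pinchScreen n n m ≤ C * (m : ℝ) ^ (-κ) := hdec
        _ ≤ max C 1 * (m : ℝ) ^ (-κ) := mul_le_mul_of_nonneg_right (le_max_left _ _) (by positivity)
        _ ≤ max C 1 * ((2 : ℝ) ^ (K + 3)) ^ (-κ) := mul_le_mul_of_nonneg_left h1 (by positivity)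
        _ = max C 1 * lam ^ (2 * (K + 3)) := by rw [h2]
    -- the ladder ends below the geometric rate: else the squeeze `λ^t ≤ C₂ λ^{2t}` forces `t ≤ q`
    have hlt : a t < lam ^ t * a 0 := by
      by_contra hge
      push Not at hge
      have hsq : (1 : ℝ) ^ 0 * lam ^ (t - 0) ≤ C₂ * lam ^ (2 * t) := by
        rw [pow_zero, one_mul, Nat.sub_zero, hC₂, div_mul_eq_mul_div, le_div_iff₀ (by positivity)]
        calc lam ^ t * (δ * η) = δ * (lam ^ t * η) := by ring
          _ ≤ δ * (lam ^ t * a 0) :=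
            mul_le_mul_of_nonneg_left (mul_le_mul_of_nonneg_left (hrt.trans_eq (ha 0).symm)
              (by positivity)) hδ.le
          _ ≤ δ * a t := mul_le_mul_of_nonneg_left hge hδ.le
          _ = δ * pinchScreen n (2 ^ K) m := by rw [hat]
          _ ≤ pinchScreen n n m := hblk
          _ ≤ max C 1 * lam ^ (2 * (K + 3)) := hdecay'
          _ ≤ max C 1 * lam ^ (2 * t) :=
            mul_le_mul_of_nonneg_left (pow_le_pow_of_le_one hlam0.le hlam1.le (by omega))
              (by positivity)
      have hcount : t ≤ 0 * 0 + q :=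
        drops_count hlam0 hlam1 (by rw [zero_add, pow_one]; exact hlam1.le) hq (Nat.zero_le t) hsq
      omega
    obtain ⟨i, hit, hpos, hdrop⟩ := exists_drop_of_lt a hlam0 ha0 t hlt
    refine ⟨k₀ + i, mem_Ico.2 ⟨by omega, by omega⟩, ?_, ?_⟩
    · rw [← ha]; exact hpos
    · rw [ha, ha] at hdrop; exact hdrop
  -- pigeonhole over `k ∈ [k₀, K)`, then read off `RootOpacityIO` at this `k` and `m`
  obtain ⟨k, hk, hfr⟩ := exists_frequently_of_eventually_exists _ hstep
  rw [mem_Ico] at hk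
  refine ⟨k, hk.1, hwin k, m, ?_, hfr.mono fun n hn => ⟨hn.1, ?_⟩⟩
  · calc 2 ^ (k + 3) ≤ 2 ^ (K + 3) := Nat.pow_le_pow_right (by norm_num) (by omega)
      _ ≤ m := hmK
  · rw [sub_sub_cancel]; exact hn.2

end Summit.CriticalPhenomena.Ising3DConformalLimit.EnergyNotSigmaSquaredGapForcesFarMerging

end
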